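import Literature.NumberTheory.EllipticCurves.PAdicMeasureTransformBranches
import Literature.NumberTheory.EllipticCurves.PAdicLFunctionInvolutionProofs
import HarnessLib

/-!
# Weight-twisted families of a bounded distribution (push-down by `d` levels), the discrete logarithm
# `ℓ : (ℤ/p^{n+e₀})ˣ → ℤ/pⁿ` to the base `γ`, and the weight of a finite-order character `ψ` of `Γ`

Topic `NumberTheory/EllipticCurves`; namespace `Literature.NumberTheory.EllipticCurves`. Three auxiliary
DEFINITIONS with bodies (`weightTwist`, `gammaLog`, `psiWeight`) + their proved API; no named fact, no
instance (D-0026). Companion of `PAdicMeasureTransformBranches`, whose `branchTwist i μ` (the `ω^i`-twist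
of a family, pushed down `e₀` levels) is the case `d = e₀`, `w = ω(·)^i` of the present `weightTwist d w μ`
(`branchTwist_eq_weightTwist`).

**The point** (Mazur–Tate–Teitelbaum 1986, §I.13: the `p`-adic `L`-function as a function on the characters
`χ = ω^i · ψ · (1+T)^{ℓ}` of `ℤ_p^× = Δ × Γ`, `x = ω(x) γ^{ℓ(x)}`). The `ω^i ψ`-branches (`ψ` a character of
`Γ = γ^{ℤ_p}` of finite order, `ψ(γ) = ε`, `ε^{p^j} = 1`; tree: `padicLFunctionMinusBranchMultTwist f α i ε`
of `PAdicLFunctionMinusMultGammaTwist`, Riemann sums weighted by `ζ^i εˢ` on the class `ζγˢ`) are the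
plain Mellin transforms of the family `x ↦ ω(x)^i ψ(⟨x⟩) μ(x)`. Since `ψ(⟨x⟩)` is only defined on classes
modulo `p^{j+e₀}`, the twisted family is PUSHED DOWN `d = j + e₀` levels (as `branchTwist` pushes down
`e₀` levels), which keeps it a distribution at every level:

* `weightTwist d w μ` — `(w·μ)(a + pⁿℤ_p) := ∑_{b mod p^{d+n}, b ≡ a (pⁿ)} μ(b + p^{d+n}ℤ_p) · w(b mod p^d)`
  for an arbitrary weight `w : ℤ/p^d → ℚ_p`; `weightTwist_distribution` (a distribution if `μ` is),
  `norm_weightTwist_le` (bounded by the bound of `μ` if `‖w‖ ≤ 1`), `weightTwist_apply_of_distribution`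
  (at levels `m ≥ d`: `(w·μ)(u + p^mℤ_p) = μ(u + p^mℤ_p) · w(u mod p^d)`), `branchTwist_eq_weightTwist`.
* `gammaLog n u` — the discrete logarithm of a unit class `u = η γˢ (mod p^{n+e₀})` to the base `γ`:
  `ℓ(u) = s ∈ ℤ/pⁿ` (junk `0` on non-units; `exists_classMap_eq_of_isUnit`, `classMap_injective`):
  `gammaLog_classMap`, `gammaLog_mul` (`ℓ(uv) = ℓ(u) + ℓ(v)`), `gammaLog_neg_one` (`ℓ(−1) = 0`),
  `castHom_classMap_of_le` / `gammaLog_castHom_classMap` (reduction of levels reduces the logarithm).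
* `psiWeight j ε u = ε^{ℓ(u)}` (`= ψ(⟨u⟩)` for the character `ψ` of `Γ` with `ψ(γ) = ε`, `ε^{p^j} = 1`;
  `0` on non-units): `psiWeight_classMap`, `norm_psiWeight_le_one`, **`psiWeight_eq_mul_of_mul_mul_eq_neg_one`**
  — for a QUADRATIC `ψ` (`ε² = 1`; at `p = 2`, `ε = −1`, `ψ = χ₂` the character of `ℚ(√2) ⊂ ℚ_∞`):
  `ψ(u) = ψ(K) ψ(u')` whenever `K u u' = −1` (`ℓ(−1/(Ku')) = −ℓ(K) − ℓ(u')`, `ψ⁻¹ = ψ`) — the behaviour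
  of the weight under the involution `x ↦ −1/(Kx)` of the functional equation (§I.17).

Consumed by `PAdicLFunctionMinusMultTwistFunctionalEquationProofs` (the functional equation of the
`ω^i ψ`-branches at a prime `p ‖ N`; cell `bsd-2adic`, additive `(−2)`-split-twist block at `p = 2`).

## References
* B. Mazur, J. Tate, J. Teitelbaum, *On `p`-adic analogues of the conjectures of Birch and
  Swinnerton-Dyer*, Invent. Math. 84 (1986), 1–48: §I.11 ((11.1) distributions), §I.13 (characters of
  `ℤ_p^×`, branches), §I.17. [MazurTateTeitelbaum1986Invent]
* L. C. Washington, *Introduction to cyclotomic fields*, GTM 83, §5.1, §7.2 (`ℤ_p^× = μ × (1 + p^{e₀}ℤ_p)`,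
  `1 + p^{e₀}ℤ_p = γ^{ℤ_p}`). [Washington1997]
-/

noncomputable section

open Filter Topology

open scoped MatrixGroups

namespace Literature.NumberTheory.EllipticCurves

variable {p : ℕ} [Fact p.Prime]

/-! ### Weight-twisted families, pushed down `d` levels -/

section WeightTwist

variable {μ : (n : ℕ) → ZMod (p ^ n) → ℚ_[p]} {d : ℕ} {w : ZMod (p ^ d) → ℚ_[p]}

variable (d w) in
/-- The **`w`-twist of a family `μ`**, pushed down `d` levels so that it is defined (and a distribution)
at every level: `(w·μ)(a + pⁿℤ_p) := ∑_{b mod p^{d+n}, b ≡ a (pⁿ)} μ(b + p^{d+n}ℤ_p) · w(b mod p^d)` for a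
weight `w` on the classes modulo `p^d`. For `n ≥ d` and `μ` a distribution it is `μ(a + pⁿℤ_p) w(a)`
(`weightTwist_apply_of_distribution`). The case `d = e₀`, `w = ω(·)^i` is `branchTwist i μ`
(Mazur–Tate–Teitelbaum 1986, §I.13: twisting the measure by a tame character).
[cite: MazurTateTeitelbaum1986Invent, §I.13] -/
def weightTwist (μ : (n : ℕ) → ZMod (p ^ n) → ℚ_[p]) (n : ℕ) (a : ZMod (p ^ n)) : ℚ_[p] :=
  ∑ b ∈ Finset.univ.filter (fun b : ZMod (p ^ (d + n)) ↦
      ZMod.castHom (pow_dvd_pow p (Nat.le_add_left n _)) (ZMod (p ^ n)) b = a),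
    μ (d + n) b * w (ZMod.castHom (pow_dvd_pow p (Nat.le_add_right _ n)) (ZMod (p ^ d)) b)

/-- `branchTwist i μ = weightTwist e₀ (ω(·)^i) μ` (definitional). [cite: MazurTateTeitelbaum1986Invent, §I.13] -/
theorem branchTwist_eq_weightTwist (i : ℕ) (μ : (n : ℕ) → ZMod (p ^ n) → ℚ_[p]) :
    branchTwist i μ = weightTwist (cyclotomicExponent p) (teichWeight p i) μ := rfl

/-- **`w·μ` is bounded by the bound of `μ`** if `‖w‖ ≤ 1` (ultrametric inequality).
[cite: MazurTateTeitelbaum1986Invent, §I.11] -/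
theorem norm_weightTwist_le {C : ℝ} (hC : ∀ (n : ℕ) (a : ZMod (p ^ n)), ‖μ n a‖ ≤ C)
    (hw : ∀ x, ‖w x‖ ≤ 1) (n : ℕ) (a : ZMod (p ^ n)) : ‖weightTwist d w μ n a‖ ≤ C := by
  classical
  have hC0 : 0 ≤ C := (norm_nonneg _).trans (hC 0 0)
  unfold weightTwist
  refine IsUltrametricDist.norm_sum_le_of_forall_le_of_nonneg hC0 fun b _ ↦ ?_
  rw [norm_mul]
  calc _ ≤ C * 1 := mul_le_mul (hC _ _) (hw _) (norm_nonneg _) hC0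
    _ = C := mul_one C

/-- **`w·μ` is a distribution if `μ` is**:
`∑_{b ≡ a (pⁿ), b mod p^{n+1}} (w·μ)(b + p^{n+1}ℤ_p) = (w·μ)(a + pⁿℤ_p)`. Both sides equal
`∑_{c ≡ a (pⁿ), c mod p^{d+n+1}} μ(c + p^{d+n+1}ℤ_p) w(c)`: the left by merging the double sum, the right by
refining each `μ(b + p^{d+n}ℤ_p)` along the distribution relation of `μ`, the weight being constant on the
fibre (verbatim `branchTwist_distribution`). [cite: MazurTateTeitelbaum1986Invent, §I.11 (11.1)] -/
theorem weightTwist_distribution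
    (hdist : ∀ (n : ℕ) (a : ZMod (p ^ n)),
      ∑ b ∈ Finset.univ.filter (fun b : ZMod (p ^ (n + 1)) ↦
        ZMod.castHom (pow_dvd_pow p n.le_succ) (ZMod (p ^ n)) b = a), μ (n + 1) b = μ n a)
    (n : ℕ) (a : ZMod (p ^ n)) :
    ∑ b ∈ Finset.univ.filter (fun b : ZMod (p ^ (n + 1)) ↦
        ZMod.castHom (pow_dvd_pow p n.le_succ) (ZMod (p ^ n)) b = a), weightTwist d w μ (n + 1) b =
      weightTwist d w μ n a := by
  classical
  have h1 : n ≤ d + n + 1 := by omega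
  have h2 : d ≤ d + n + 1 := by omega
  have h3 : d + n ≤ d + n + 1 := by omega
  -- the common value of both sides
  trans ∑ c ∈ Finset.univ.filter (fun c : ZMod (p ^ (d + n + 1)) ↦
      ZMod.castHom (pow_dvd_pow p h1) (ZMod (p ^ n)) c = a),
    μ (d + n + 1) c * w (ZMod.castHom (pow_dvd_pow p h2) (ZMod (p ^ d)) c)
  · -- merge the double sum
    simp only [weightTwist]
    rw [← Finset.sum_fiberwise_of_maps_to
      (s := Finset.univ.filter (fun c : ZMod (p ^ (d + n + 1)) ↦
        ZMod.castHom (pow_dvd_pow p h1) (ZMod (p ^ n)) c = a))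
      (t := Finset.univ.filter (fun b : ZMod (p ^ (n + 1)) ↦
        ZMod.castHom (pow_dvd_pow p n.le_succ) (ZMod (p ^ n)) b = a))
      (g := ZMod.castHom (pow_dvd_pow p (Nat.le_add_left (n + 1) d)) (ZMod (p ^ (n + 1))))]
    · refine Finset.sum_congr rfl fun b hb ↦ ?_
      refine Finset.sum_congr ?_ fun _ _ ↦ rfl
      ext c
      simp only [Finset.mem_filter, Finset.mem_univ, true_and, iff_and_self]
      intro hc
      rw [← (Finset.mem_filter.mp hb).2, ← hc, castHom_castHom_zmod]
    · intro c hc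
      simp only [Finset.mem_filter, Finset.mem_univ, true_and] at hc ⊢
      rw [castHom_castHom_zmod]
      exact hc
  · -- refine along the distribution relation of `μ`
    symm
    simp only [weightTwist]
    rw [← Finset.sum_fiberwise_of_maps_to
      (s := Finset.univ.filter (fun c : ZMod (p ^ (d + n + 1)) ↦
        ZMod.castHom (pow_dvd_pow p h1) (ZMod (p ^ n)) c = a))
      (t := Finset.univ.filter (fun b : ZMod (p ^ (d + n)) ↦
        ZMod.castHom (pow_dvd_pow p (Nat.le_add_left n d)) (ZMod (p ^ n)) b = a))
      (g := ZMod.castHom (pow_dvd_pow p h3) (ZMod (p ^ (d + n))))]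
    · refine Finset.sum_congr rfl fun b hb ↦ ?_
      rw [← hdist (d + n) b, Finset.sum_mul]
      refine Finset.sum_congr ?_ fun c hc ↦ ?_
      · ext c
        simp only [Finset.mem_filter, Finset.mem_univ, true_and, iff_and_self]
        intro hc
        rw [← (Finset.mem_filter.mp hb).2, ← hc, castHom_castHom_zmod]
      · have hcb : ZMod.castHom (pow_dvd_pow p (d + n).le_succ) (ZMod (p ^ (d + n))) c = b := by
          have := (Finset.mem_filter.mp hc).2
          exact this
        rw [← hcb, castHom_castHom_zmod]
    · intro c hc
      simp only [Finset.mem_filter, Finset.mem_univ, true_and] at hc ⊢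
      rw [castHom_castHom_zmod]
      exact hc

/-- **At levels `m ≥ d`, `(w·μ)(u + p^mℤ_p) = μ(u + p^mℤ_p) · w(u mod p^d)`** for a distribution `μ`:
the weight is constant on the fibre over `u` and the fibre sum of `μ` is `μ(u + p^mℤ_p)`
(`sum_fiber_of_distribution`; verbatim `branchTwist_apply_of_distribution`).
[cite: MazurTateTeitelbaum1986Invent, §I.13] -/
theorem weightTwist_apply_of_distribution
    (hdist : ∀ (n : ℕ) (a : ZMod (p ^ n)),
      ∑ b ∈ Finset.univ.filter (fun b : ZMod (p ^ (n + 1)) ↦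
        ZMod.castHom (pow_dvd_pow p n.le_succ) (ZMod (p ^ n)) b = a), μ (n + 1) b = μ n a)
    {m : ℕ} (hm : d ≤ m) (u : ZMod (p ^ m)) :
    weightTwist d w μ m u = μ m u * w (ZMod.castHom (pow_dvd_pow p hm) (ZMod (p ^ d)) u) := by
  classical
  unfold weightTwist
  rw [← sum_fiber_of_distribution hdist (Nat.le_add_left m d) u, Finset.sum_mul]
  refine Finset.sum_congr rfl fun b hb ↦ ?_
  have hbu : ZMod.castHom (pow_dvd_pow p (Nat.le_add_left m d)) (ZMod (p ^ m)) b = u :=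
    (Finset.mem_filter.mp hb).2
  rw [← hbu, castHom_castHom_zmod]

end WeightTwist

/-! ### The discrete logarithm to the base `γ` on the unit classes modulo `p^{n+e₀}` -/

section GammaLog

variable (p)

/-- The **discrete logarithm** of a unit class `u` modulo `p^{n+e₀}` to the base `γ = cyclotomicGenerator p`:
the unique `s ∈ ℤ/pⁿ` with `u = η γˢ` for a (unique) Teichmüller `η ∈ μ_τ(ℤ_p)` (`exists_classMap_eq_of_isUnit`,
`classMap_injective`; Washington §7.2: `ℤ_p^× = μ × γ^{ℤ_p}`); junk value `0` on non-units. In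
Mazur–Tate–Teitelbaum's notation `u = ω(u)⟨u⟩`, `⟨u⟩ = γ^{ℓ(u)}`, this is `ℓ(u) mod pⁿ`.
[cite: Washington1997, §7.2] [cite: MazurTateTeitelbaum1986Invent, §I.13] -/
def gammaLog (n : ℕ) (u : ZMod (p ^ (n + cyclotomicExponent p))) : ZMod (p ^ n) :=
  if h : IsUnit u then (exists_classMap_eq_of_isUnit p n h).choose_spec.choose else 0

/-- **`ℓ(η γˢ) = s`.** [cite: Washington1997, §7.2] -/
theorem gammaLog_classMap (n : ℕ) (η : rootsOfUnity (torsionOrder p) ℤ_[p]) (s : ZMod (p ^ n)) :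
    gammaLog p n (PadicInt.toZModPow (n + cyclotomicExponent p) ((η : ℤ_[p]ˣ) : ℤ_[p]) *
        (cyclotomicGenerator p : ZMod (p ^ (n + cyclotomicExponent p))) ^ s.val) = s := by
  have hu := isUnit_classMap p n (η, s)
  dsimp only at hu
  unfold gammaLog
  rw [dif_pos hu]
  have hspec := (exists_classMap_eq_of_isUnit p n hu).choose_spec.choose_spec
  have hinj := classMap_injective p n
    (a₁ := ((exists_classMap_eq_of_isUnit p n hu).choose,
      (exists_classMap_eq_of_isUnit p n hu).choose_spec.choose))
    (a₂ := (η, s)) hspec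
  exact congrArg Prod.snd hinj

/-- **`ℓ(uv) = ℓ(u) + ℓ(v)`** on units (`classMap_mul`). [cite: Washington1997, §7.2] -/
theorem gammaLog_mul (n : ℕ) {u v : ZMod (p ^ (n + cyclotomicExponent p))} (hu : IsUnit u)
    (hv : IsUnit v) : gammaLog p n (u * v) = gammaLog p n u + gammaLog p n v := by
  obtain ⟨η, s, rfl⟩ := exists_classMap_eq_of_isUnit p n hu
  obtain ⟨η', s', rfl⟩ := exists_classMap_eq_of_isUnit p n hv
  rw [← classMap_mul, gammaLog_classMap, gammaLog_classMap, gammaLog_classMap]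

/-- **`ℓ(−1) = 0`** (`−1` is a Teichmüller representative, `classMap_neg_one`). [cite: Washington1997, §7.2] -/
theorem gammaLog_neg_one (n : ℕ) :
    gammaLog p n (-1 : ZMod (p ^ (n + cyclotomicExponent p))) = 0 := by
  rw [← classMap_neg_one p n, gammaLog_classMap]

/-- `ℓ(1) = 0`. [cite: Washington1997, §7.2] -/
theorem gammaLog_one (n : ℕ) : gammaLog p n (1 : ZMod (p ^ (n + cyclotomicExponent p))) = 0 := by
  rw [← classMap_one p n, gammaLog_classMap]

/-- **Reduction of levels on the classes**: for `j ≤ n`, the class `η γˢ mod p^{n+e₀}` (`s mod pⁿ`) reduces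
modulo `p^{j+e₀}` to the class `η γ^{s mod p^j}` (`γ` has order `p^j` modulo `p^{j+e₀}`,
`orderOf_cyclotomicGenerator`; the one-step case is `castHom_classMap_succ`). [cite: Washington1997, §7.2] -/
theorem castHom_classMap_of_le {j n : ℕ} (h : j ≤ n) (η : rootsOfUnity (torsionOrder p) ℤ_[p])
    (s : ZMod (p ^ n)) :
    ZMod.castHom (pow_dvd_pow p (Nat.add_le_add_right h (cyclotomicExponent p)))
        (ZMod (p ^ (j + cyclotomicExponent p)))
        (PadicInt.toZModPow (n + cyclotomicExponent p) ((η : ℤ_[p]ˣ) : ℤ_[p]) *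
          (cyclotomicGenerator p : ZMod (p ^ (n + cyclotomicExponent p))) ^ s.val) =
      PadicInt.toZModPow (j + cyclotomicExponent p) ((η : ℤ_[p]ˣ) : ℤ_[p]) *
        (cyclotomicGenerator p : ZMod (p ^ (j + cyclotomicExponent p))) ^
          ((s.val : ZMod (p ^ j))).val := by
  have hle : j + cyclotomicExponent p ≤ n + cyclotomicExponent p :=
    Nat.add_le_add_right h (cyclotomicExponent p)
  have hpow : (cyclotomicGenerator p : ZMod (p ^ (j + cyclotomicExponent p))) ^ (s.val % p ^ j) =
      (cyclotomicGenerator p : ZMod (p ^ (j + cyclotomicExponent p))) ^ s.val := by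
    have h := pow_mod_orderOf (cyclotomicGenerator p : ZMod (p ^ (j + cyclotomicExponent p))) s.val
    rwa [orderOf_cyclotomicGenerator p j] at h
  rw [map_mul, map_pow, map_natCast, ZMod.castHom_apply, PadicInt.cast_toZModPow _ _ hle,
    ZMod.val_natCast, hpow]

/-- **Reduction of levels reduces the logarithm**: `ℓ_j(η γˢ mod p^{j+e₀}) = s mod p^j` for the class
`η γˢ` of level `n ≥ j`. [cite: Washington1997, §7.2] -/
theorem gammaLog_castHom_classMap {j n : ℕ} (h : j ≤ n) (η : rootsOfUnity (torsionOrder p) ℤ_[p])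
    (s : ZMod (p ^ n)) :
    gammaLog p j (ZMod.castHom (pow_dvd_pow p (Nat.add_le_add_right h (cyclotomicExponent p)))
        (ZMod (p ^ (j + cyclotomicExponent p)))
        (PadicInt.toZModPow (n + cyclotomicExponent p) ((η : ℤ_[p]ˣ) : ℤ_[p]) *
          (cyclotomicGenerator p : ZMod (p ^ (n + cyclotomicExponent p))) ^ s.val)) =
      (s.val : ZMod (p ^ j)) := by
  rw [castHom_classMap_of_le p h, gammaLog_classMap]

end GammaLog

/-! ### The weight `ψ(⟨u⟩) = ε^{ℓ(u)}` of a finite-order character `ψ` of `Γ`, `ψ(γ) = ε` -/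

section PsiWeight

variable (p)

/-- The **weight of the character `ψ` of `Γ` with `ψ(γ) = ε`** on the classes modulo `p^{j+e₀}`:
`ψ(⟨u⟩) = ε^{ℓ(u)}` with `ℓ = gammaLog p j` (well defined on `ℓ(u) ∈ ℤ/p^j` when `ε^{p^j} = 1`), extended by
`0` on the non-units. At `p = 2`, `j = 1`, `ε = −1`: `ψ = χ₂`, the character of `ℚ(√2) = ℚ₁ ⊂ ℚ_∞`, read on
`u mod 8` (`+1` on `±1`, `−1` on `±5 ≡ ±3`). The Riemann sums of `padicLFunctionMinusBranchMultTwist f α i ε`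
carry exactly the factor `εˢ = ψ(⟨ζγˢ⟩)` (Mazur–Tate–Teitelbaum 1986, §I.13).
[cite: MazurTateTeitelbaum1986Invent, §I.13] -/
def psiWeight (j : ℕ) (ε : ℚ_[p]) (u : ZMod (p ^ (j + cyclotomicExponent p))) : ℚ_[p] :=
  if IsUnit u then ε ^ (gammaLog p j u).val else 0

variable {j : ℕ} {ε : ℚ_[p]}

/-- `ψ(⟨η γˢ⟩) = εˢ` (`s ∈ ℤ/p^j` represented in `[0, p^j)`). [cite: MazurTateTeitelbaum1986Invent, §I.13] -/
theorem psiWeight_classMap (η : rootsOfUnity (torsionOrder p) ℤ_[p]) (s : ZMod (p ^ j)) :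
    psiWeight p j ε (PadicInt.toZModPow (j + cyclotomicExponent p) ((η : ℤ_[p]ˣ) : ℤ_[p]) *
        (cyclotomicGenerator p : ZMod (p ^ (j + cyclotomicExponent p))) ^ s.val) = ε ^ s.val := by
  have hu := isUnit_classMap p j (η, s)
  dsimp only at hu
  rw [psiWeight, if_pos hu, gammaLog_classMap]

/-- `ε^{a mod m} = ε^a` when `ε^m = 1`. [folklore] -/
private theorem pow_mod_eq_pow_of_pow_eq_one {R : Type*} [Monoid R] {x : R} {m : ℕ} (hx : x ^ m = 1) (a : ℕ) :
    x ^ (a % m) = x ^ a := by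
  conv_rhs => rw [← Nat.mod_add_div a m, pow_add, pow_mul, hx, one_pow, mul_one]

/-- **`ψ(⟨·⟩)` on a class of higher level**: for `n ≥ j` and `ε^{p^j} = 1`, the weight of the class
`ζ γˢ mod p^{n+e₀}` (`s ∈ ℤ/pⁿ`), read after reduction modulo `p^{j+e₀}`, is `ε^{s}` — the factor of the
twisted Riemann sums `padicLMinusBranchMultTwistRiemannSum`. [cite: MazurTateTeitelbaum1986Invent, §I.13] -/
theorem psiWeight_castHom_classMap (hε : ε ^ p ^ j = 1) {n : ℕ} (h : j ≤ n)
    (η : rootsOfUnity (torsionOrder p) ℤ_[p]) (s : ZMod (p ^ n)) :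
    psiWeight p j ε (ZMod.castHom (pow_dvd_pow p (Nat.add_le_add_right h (cyclotomicExponent p)))
        (ZMod (p ^ (j + cyclotomicExponent p)))
        (PadicInt.toZModPow (n + cyclotomicExponent p) ((η : ℤ_[p]ˣ) : ℤ_[p]) *
          (cyclotomicGenerator p : ZMod (p ^ (n + cyclotomicExponent p))) ^ s.val)) = ε ^ s.val := by
  rw [castHom_classMap_of_le p h, psiWeight_classMap, ZMod.val_natCast, pow_mod_eq_pow_of_pow_eq_one hε]

/-- `‖ψ(⟨u⟩)‖ ≤ 1` if `‖ε‖ ≤ 1`. [cite: MazurTateTeitelbaum1986Invent, §I.13] -/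
theorem norm_psiWeight_le_one (hε : ‖ε‖ ≤ 1) (u : ZMod (p ^ (j + cyclotomicExponent p))) :
    ‖psiWeight p j ε u‖ ≤ 1 := by
  unfold psiWeight
  split_ifs
  · rw [norm_pow]; exact pow_le_one₀ (norm_nonneg _) hε
  · rw [norm_zero]; exact zero_le_one

/-- The exponential `s ↦ εˢ` on `ℤ/p^j` is additive when `ε^{p^j} = 1`. [folklore] -/
private theorem pow_val_add_eq (hε : ε ^ p ^ j = 1) (x y : ZMod (p ^ j)) :
    ε ^ (x + y).val = ε ^ x.val * ε ^ y.val := by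
  haveI : NeZero (p ^ j) := ⟨pow_ne_zero _ (Fact.out : p.Prime).ne_zero⟩
  rw [ZMod.val_add, pow_mod_eq_pow_of_pow_eq_one hε, pow_add]

/-- For a quadratic `ε` (`ε² = 1`) the exponential is even: `ε^{−s} = εˢ`. [folklore] -/
private theorem pow_val_neg_eq (hε : ε ^ p ^ j = 1) (hε2 : ε ^ 2 = 1) (x : ZMod (p ^ j)) :
    ε ^ (-x).val = ε ^ x.val := by
  haveI : NeZero (p ^ j) := ⟨pow_ne_zero _ (Fact.out : p.Prime).ne_zero⟩
  have h1 : ε ^ (-x).val * ε ^ x.val = 1 := by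
    rw [← pow_val_add_eq p hε, neg_add_cancel, ZMod.val_zero, pow_zero]
  have h2 : ε ^ x.val * ε ^ x.val = 1 := by
    rw [← pow_add, ← two_mul, pow_mul, hε2, one_pow]
  have hx0 : ε ^ x.val ≠ 0 := fun h0 ↦ by rw [h0, mul_zero] at h2; exact zero_ne_one h2
  exact mul_right_cancel₀ hx0 (h1.trans h2.symm)

/-- **The `ψ`-weight along the involution `x ↦ −1/(Kx)`** for a QUADRATIC character (`ε^{p^j} = 1`,
`ε² = 1`): if `K u u' = −1` modulo `p^{j+e₀}` then `ψ(⟨u⟩) = ψ(⟨K⟩) · ψ(⟨u'⟩)` — from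
`ℓ(K) + ℓ(u) + ℓ(u') = ℓ(−1) = 0` (`gammaLog_mul`, `gammaLog_neg_one`) and `ψ⁻¹ = ψ`. This is the factor by
which the change of variables of Mazur–Tate–Teitelbaum §I.17 moves the `ψ`-twisted measure.
[cite: MazurTateTeitelbaum1986Invent, §I.13 and §I.17] -/
theorem psiWeight_eq_mul_of_mul_mul_eq_neg_one (hε : ε ^ p ^ j = 1) (hε2 : ε ^ 2 = 1)
    {K u u' : ZMod (p ^ (j + cyclotomicExponent p))} (h : K * u * u' = -1) :
    psiWeight p j ε u = psiWeight p j ε K * psiWeight p j ε u' := by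
  -- all three are units
  have hKab : K * u * u' * (K * u * u') = 1 := by rw [h]; ring
  have hu : IsUnit u := IsUnit.of_mul_eq_one (K * u' * (K * u * u')) (by linear_combination hKab)
  have hu' : IsUnit u' := IsUnit.of_mul_eq_one (K * u * (K * u * u')) (by linear_combination hKab)
  have hK : IsUnit K := IsUnit.of_mul_eq_one (u * u' * (K * u * u')) (by linear_combination hKab)
  simp only [psiWeight, if_pos hu, if_pos hu', if_pos hK]
  -- `ℓ(K) + ℓ(u) + ℓ(u') = 0`
  have hlog : gammaLog p j K + gammaLog p j u + gammaLog p j u' = 0 := by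
    rw [← gammaLog_mul p j hK hu, ← gammaLog_mul p j (hK.mul hu) hu', h, gammaLog_neg_one]
  have hlu : gammaLog p j u = -(gammaLog p j K + gammaLog p j u') := by
    linear_combination hlog
  rw [hlu, pow_val_neg_eq p hε hε2, pow_val_add_eq p hε]

/-- **`ψ(⟨u⟩) = ±1 ∈ ℤ` for a quadratic `ψ`** (`ε² = 1`, `u` a unit class): `∃ w ∈ ℤ`, `w² = 1`,
`(w : ℚ_p) = psiWeight p j ε u`. [cite: MazurTateTeitelbaum1986Invent, §I.13] -/
theorem exists_int_cast_eq_psiWeight (hε2 : ε ^ 2 = 1) {u : ZMod (p ^ (j + cyclotomicExponent p))}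
    (hu : IsUnit u) : ∃ w : ℤ, w ^ 2 = 1 ∧ (w : ℚ_[p]) = psiWeight p j ε u := by
  rw [psiWeight, if_pos hu]
  have h2 : (ε ^ (gammaLog p j u).val) * (ε ^ (gammaLog p j u).val) = 1 := by
    rw [← pow_add, ← two_mul, pow_mul, hε2, one_pow]
  rcases mul_self_eq_one_iff.mp h2 with h | h
  · exact ⟨1, by norm_num, by rw [h]; push_cast; rfl⟩
  · exact ⟨-1, by norm_num, by rw [h]; push_cast; rfl⟩

end PsiWeight

end Literature.NumberTheory.EllipticCurves

end
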